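import Mathlib
import Summits.Ventures.HodgeRepro.CMType
import Summits.Ventures.HodgeRepro.HodgeSets
import Summits.Ventures.HodgeRepro.CMRank

/-!
# The μ-table of a CM type (blind cell `pub-hodge-repro`, seat p2)

Built on the typer's interface (`IsComplexConj`, `IsCMType`, `IsHodgeSet`, `ind`, `typeMatrix`,
`cmRank`).  `G` is a finite group (the Galois group of a Galois CM field `E/ℚ`, identified with
`Hom(E, ℂ)` by fixing one embedding), `c ∈ G` the central involution induced by complex conjugation,
and a CM type is a `Φ : Finset G` containing exactly one of each pair `{g, c * g}`.

Printed source (Deligne, *Hodge cycles on abelian varieties*, notes by Milne, LNM 900; typed version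
pp. 25–26 Example 3.7 and pp. 37–40 §5):

* Ex. 3.7: `H₁(A) ⊗ ℂ ≅ ℂ^S = ℂ^Φ ⊕ ℂ^{Φ̄}`, `μ(z)` acts as `z` on `ℂ^Φ` and as `1` on `ℂ^{Φ̄}`; the
  cocharacter `μ ∈ Y(E^×) × Y(𝔾_m) = ℤ^S × ℤ` is `μ = Σ_{s ∈ Φ} e_s + e_0`; `Y(G)` is the
  `Gal(ℚ̄/ℚ)`-module generated by `μ`; (d) `μ + ῑμ = 1` on `S`.
* §5, proof of Lemma 5.2: `σμ = Σ Φ(s) y_{σs,Φ} + y_0` and `⟨σμ, x⟩ = Σ_Φ d(Φ) Φ(σ⁻¹ s₀) − d/2` for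
  `x = Σ_Φ d(Φ) x_{s₀,Φ} − (d/2) x_0`.

The *μ-table* of `Φ` is the table of the pairings of the Galois conjugates `gμ` (`g ∈ G`) against the
characters of the torus `E^×`: for a character `x_S = Σ_{s ∈ S} x_s` attached to a subset `S ⊆ G`,
`⟨gμ, x_S⟩ = |S ∩ gΦ|`; for a general character `n = Σ n_s x_s` it is `Σ_{s ∈ gΦ} n_s`.  Its matrix
is the typer's `typeMatrix Φ` (row `g` = indicator of `gΦ`); column `s` is the *weight* of the
character `x_s` on the Mumford–Tate torus, read in the coordinates `⟨gμ, ·⟩`.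
-/

open Finset
open scoped Pointwise

namespace HodgeRepro

variable {G : Type*} [Group G]

/-! ### The μ-value of a subset -/

section Mu

variable [DecidableEq G]

/-- The μ-value of the subset `S` at `g ∈ G`: the pairing `⟨gμ, x_S⟩ = |S ∩ gΦ|` of the Galois
conjugate `gμ` of the Hodge cocharacter with the character `x_S = Σ_{s ∈ S} x_s`
(Deligne Ex. 3.7 / Lemma 5.2, for the 0/1 vector of `S`). -/
def muVal (Φ S : Finset G) (g : G) : ℕ := (S ∩ g • Φ).card

variable {Φ S T : Finset G}

/-- `muVal` unfolds to `|S ∩ gΦ|`. -/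
theorem muVal_def (Φ S : Finset G) (g : G) : muVal Φ S g = (S ∩ g • Φ).card := rfl

/-- At `g = 1` the μ-value is the Hodge `p`-type `|S ∩ Φ|` of the basis vector `⟨S⟩`. -/
theorem muVal_one (Φ S : Finset G) : muVal Φ S 1 = hodgeP Φ S := by
  simp [muVal, hodgeP]

/-- The μ-value at `g` is the Hodge `p`-type for the translated CM type `gΦ`. -/
theorem muVal_eq_hodgeP (Φ S : Finset G) (g : G) : muVal Φ S g = hodgeP (g • Φ) S := rfl

/-- The μ-value is at most `|S|`. -/
theorem muVal_le_card (Φ S : Finset G) (g : G) : muVal Φ S g ≤ S.card :=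
  card_le_card inter_subset_left

/-- The μ-value is at most `|Φ|`. -/
theorem muVal_le_card_type (Φ S : Finset G) (g : G) : muVal Φ S g ≤ Φ.card := by
  rw [← card_smul_finset g Φ]
  exact card_le_card inter_subset_right

/-- The μ-value of the empty set is `0`. -/
@[simp] theorem muVal_empty (Φ : Finset G) (g : G) : muVal Φ ∅ g = 0 := by
  simp [muVal]

/-- The μ-value of the whole group is `|Φ|`. -/
@[simp] theorem muVal_univ [Fintype G] (Φ : Finset G) (g : G) : muVal Φ univ g = Φ.card := by
  simp [muVal]

/-- The μ-value of `S` for the conjugate type `c • Φ`, read off the table of `Φ`. -/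
theorem muVal_smul_type (c : G) (Φ S : Finset G) (g : G) :
    muVal (c • Φ) S g = muVal Φ S (g * c) := by
  simp [muVal, smul_smul]

/-- Translation rule: the table is `G`-equivariant, `⟨(hg)μ, x_{hS}⟩ = ⟨gμ, x_S⟩`. -/
theorem muVal_smul (Φ S : Finset G) (h g : G) : muVal Φ (h • S) (h * g) = muVal Φ S g := by
  simp only [muVal, ← smul_smul, ← smul_finset_inter, card_smul_finset]

/-- Translation rule, solved for the subset: `⟨gμ, x_{hS}⟩ = ⟨(h⁻¹g)μ, x_S⟩`. -/
theorem muVal_smul' (Φ S : Finset G) (h g : G) : muVal Φ (h • S) g = muVal Φ S (h⁻¹ * g) := by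
  conv_lhs => rw [← mul_inv_cancel_left h g, muVal_smul]

/-- Additivity of the table in the subset, for disjoint subsets. -/
theorem muVal_union_of_disjoint (Φ : Finset G) (hST : Disjoint S T) (g : G) :
    muVal Φ (S ∪ T) g = muVal Φ S g + muVal Φ T g := by
  unfold muVal
  rw [union_inter_distrib_right, card_union_of_disjoint (hST.mono inter_subset_left inter_subset_left)]

/-- Complement rule: `⟨gμ, x_{Sᶜ}⟩ + ⟨gμ, x_S⟩ = |Φ|`. -/
theorem muVal_compl_add [Fintype G] (Φ S : Finset G) (g : G) :
    muVal Φ Sᶜ g + muVal Φ S g = Φ.card := by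
  rw [← muVal_union_of_disjoint Φ disjoint_compl_left, union_comm, union_compl, muVal_univ]

/-- Conjugation rule (Deligne Ex. 3.7 (d), `μ + ῑμ = 1` on `S`): `⟨gμ, x_S⟩ + ⟨(cg)μ, x_S⟩ = |S|`. -/
theorem muVal_add_muVal_conj [Fintype G] {c : G} (hc : IsComplexConj c) (hΦ : IsCMType c Φ)
    (S : Finset G) (g : G) : muVal Φ S g + muVal Φ S (c * g) = S.card := by
  have hg : IsCMType c (g • Φ) := hΦ.smul hc g
  have h1 : (c * g) • Φ = (g • Φ)ᶜ := by
    rw [← hg.smul_eq_compl hc, smul_smul]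
  unfold muVal
  rw [h1, ← sdiff_eq_inter_compl, add_comm, card_sdiff_add_card_inter]

/-- Pohlmann's condition in μ-table form: `Δ` is a Hodge set iff `2·⟨gμ, x_Δ⟩ = |Δ|` for all `g`
(the class `⟨Δ⟩` is of type `(|Δ|/2, |Δ|/2)` for every Galois conjugate Hodge structure). -/
theorem isHodgeSet_iff_muVal [Fintype G] {c : G} (hc : IsComplexConj c) (hΦ : IsCMType c Φ)
    (Δ : Finset G) : IsHodgeSet c Φ Δ ↔ ∀ g : G, 2 * muVal Φ Δ g = Δ.card :=
  isHodgeSet_iff_two_mul hc hΦ Δ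

/-- Pohlmann's condition in μ-table form with the half-degree `p` explicit. -/
theorem isHodgeSet_iff_muVal_eq [Fintype G] {c : G} (hc : IsComplexConj c) (hΦ : IsCMType c Φ)
    (Δ : Finset G) (p : ℕ) (hΔ : Δ.card = 2 * p) :
    IsHodgeSet c Φ Δ ↔ ∀ g : G, muVal Φ Δ g = p :=
  isHodgeSet_iff_forall_card_eq hc hΦ Δ p hΔ

/-- Disjoint unions of Hodge sets are Hodge sets. -/
theorem IsHodgeSet.union [Fintype G] {c : G} (hc : IsComplexConj c) (hΦ : IsCMType c Φ)
    (hS : IsHodgeSet c Φ S) (hT : IsHodgeSet c Φ T) (hST : Disjoint S T) :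
    IsHodgeSet c Φ (S ∪ T) := by
  rw [isHodgeSet_iff_muVal hc hΦ] at hS hT ⊢
  intro g
  rw [muVal_union_of_disjoint Φ hST, card_union_of_disjoint hST]
  have := hS g
  have := hT g
  omega

/-- The pair `{s, c * s}` is a Hodge set of size `2` (a divisor class). -/
theorem isHodgeSet_pair [Fintype G] {c : G} (hc : IsComplexConj c) (Φ : Finset G) (s : G) :
    IsHodgeSet c Φ {s, c * s} := by
  apply isHodgeSet_of_smul_eq hc
  ext x
  rw [hc.mem_smul_iff]
  simp only [mem_insert, mem_singleton]
  constructor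
  · rintro (h | h)
    · right; rw [← h, ← mul_assoc, hc.mul_self, one_mul]
    · left; exact mul_left_cancel h
  · rintro (h | h)
    · right; rw [h]
    · left; rw [h, ← mul_assoc, hc.mul_self, one_mul]

end Mu

/-! ### The integer pairing `⟨gμ, n⟩` for an arbitrary character `n = Σ n_s x_s` -/

section Pair

variable [DecidableEq G]

/-- `⟨gμ, n⟩ = Σ_{s ∈ gΦ} n_s`: the pairing of the conjugate cocharacter `gμ = Σ_{s ∈ gΦ} e_s + e_0`
with the character `n ∈ X(E^×) = ℤ^S` (the `e_0`-component is left out; it pairs to the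
`x_0`-coefficient, added separately by the caller as in Lemma 5.2). -/
def muPair (Φ : Finset G) (n : G → ℤ) (g : G) : ℤ := ∑ s ∈ g • Φ, n s

/-- The pairing of the 0/1 vector of `S` is the μ-value. -/
theorem muPair_indicator (Φ S : Finset G) (g : G) :
    muPair Φ (fun s => if s ∈ S then 1 else 0) g = (muVal Φ S g : ℤ) := by
  unfold muPair muVal
  rw [Finset.sum_ite_mem, inter_comm, Finset.sum_const, nsmul_eq_mul, mul_one]

/-- Conjugation rule for the pairing: `⟨gμ, n⟩ + ⟨(cg)μ, n⟩ = Σ_s n_s`. -/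
theorem muPair_add_muPair_conj [Fintype G] {c : G} {Φ : Finset G} (hc : IsComplexConj c)
    (hΦ : IsCMType c Φ) (n : G → ℤ) (g : G) :
    muPair Φ n g + muPair Φ n (c * g) = ∑ s, n s := by
  have hg : IsCMType c (g • Φ) := hΦ.smul hc g
  have h1 : (c * g) • Φ = (g • Φ)ᶜ := by
    rw [← hg.smul_eq_compl hc, smul_smul]
  unfold muPair
  rw [h1, Finset.sum_add_sum_compl]

/-- The pairing is additive in the character. -/
theorem muPair_add (Φ : Finset G) (n m : G → ℤ) (g : G) :
    muPair Φ (n + m) g = muPair Φ n g + muPair Φ m g := by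
  unfold muPair
  simp [Finset.sum_add_distrib]

/-- The pairing is ℤ-homogeneous in the character. -/
theorem muPair_smul (Φ : Finset G) (k : ℤ) (n : G → ℤ) (g : G) :
    muPair Φ (k • n) g = k * muPair Φ n g := by
  unfold muPair
  simp [Finset.mul_sum]

/-- Deligne's formula in the proof of Lemma 5.2: for a family of CM types `Φ_i` with multiplicities
`d i`, the character `x = Σ_i d i · x_{s₀, Φ_i}` pairs with `σμ` to `Σ_i d i · [σ⁻¹ s₀ ∈ Φ_i]`, i.e.
`Σ_i d i · Φ_i(σ⁻¹ s₀)`. -/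
theorem deligne_pairing {ι : Type*} (I : Finset ι) (Φ : ι → Finset G) (d : ι → ℤ) (s₀ σ : G) :
    ∑ i ∈ I, d i * (if s₀ ∈ σ • Φ i then 1 else 0) =
      ∑ i ∈ I, d i * (if σ⁻¹ * s₀ ∈ Φ i then 1 else 0) := by
  refine Finset.sum_congr rfl fun i _ => ?_
  have h : s₀ ∈ σ • Φ i ↔ σ⁻¹ * s₀ ∈ Φ i := by rw [← inv_smul_mem_iff, smul_eq_mul]
  simp only [h]

/-! #### Family version (Deligne §5): several CM types at once -/

/-- For a family of CM types `Φ i` (`i ∈ ι`, Deligne's family `(A_Φ)`), the Galois conjugate `σμ` of the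
cocharacter `μ = Σ_{s,i} Φ_i(s) y_{s,i} + y_0` pairs with the character `x = Σ n_{s,i} x_{s,i} + n_0 x_0`
to `Σ_i Σ_{s ∈ σΦ_i} n_{s,i} + n_0`. -/
def muPairFam {ι : Type*} [Fintype ι] (Φ : ι → Finset G) (n : G → ι → ℤ) (n₀ : ℤ) (σ : G) : ℤ :=
  ∑ i, ∑ s ∈ σ • Φ i, n s i + n₀

/-- Deligne's computation in the proof of Lemma 5.2: for `x = Σ_i d(i) x_{s₀,i} − (d/2) x_0` (here with an
arbitrary constant term `n₀`), `⟨σμ, x⟩ = Σ_i d(i) Φ_i(σ⁻¹ s₀) + n₀`. -/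
theorem muPairFam_single {ι : Type*} [Fintype ι] (Φ : ι → Finset G) (d : ι → ℤ) (n₀ : ℤ)
    (s₀ σ : G) :
    muPairFam Φ (fun s i => if s = s₀ then d i else 0) n₀ σ =
      ∑ i, d i * (if σ⁻¹ * s₀ ∈ Φ i then 1 else 0) + n₀ := by
  unfold muPairFam
  congr 1
  refine Finset.sum_congr rfl fun i _ => ?_
  have h : s₀ ∈ σ • Φ i ↔ σ⁻¹ * s₀ ∈ Φ i := by rw [← inv_smul_mem_iff, smul_eq_mul]
  rw [Finset.sum_ite_eq']
  simp only [h]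
  by_cases h' : σ⁻¹ * s₀ ∈ Φ i <;> simp [h']

/-- The pair `(Φ, c • Φ)` with multiplicities `1, 1` and constant term `−1` pairs to zero with every `σμ`
(Deligne: "As `Φ + Φ̄ = 1`, `x_{s₀,Φ} + x_{s₀,Φ̄} − x_0 ∈ Y(G^H)^⊥`"). -/
theorem pair_conj_pairing_eq_zero [Fintype G] {c : G} {Φ : Finset G} (hc : IsComplexConj c)
    (hΦ : IsCMType c Φ) (s₀ σ : G) :
    ((if σ⁻¹ * s₀ ∈ Φ then 1 else 0) + (if σ⁻¹ * s₀ ∈ c • Φ then 1 else 0) : ℤ) - 1 = 0 := by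
  rw [hΦ.smul_eq_compl hc]
  simp only [Finset.mem_compl]
  by_cases h : σ⁻¹ * s₀ ∈ Φ <;> simp [h]

end Pair

/-! ### The μ-table as a matrix: rows `gμ`, columns = weights of the characters `x_s` -/

section Table

variable [DecidableEq G] [Fintype G]

/-- Row `g` of the μ-table (`typeMatrix Φ`), applied to the 0/1 vector of `S`, is the μ-value `|S ∩ gΦ|`. -/
theorem typeMatrix_mulVec_ind (Φ S : Finset G) (g : G) :
    (typeMatrix Φ).mulVec (ind S) g = (muVal Φ S g : ℚ) := by
  unfold muVal
  simp only [Matrix.mulVec, dotProduct, typeMatrix, ind]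
  have key : ∀ s, (if s ∈ g • Φ then (1 : ℚ) else 0) * (if s ∈ S then 1 else 0) =
      if s ∈ S ∩ g • Φ then 1 else 0 := by
    intro s
    by_cases h1 : s ∈ g • Φ <;> by_cases h2 : s ∈ S <;> simp [h1, h2]
  simp only [key]
  rw [Finset.sum_ite_mem_eq, Finset.sum_const, nsmul_eq_mul, mul_one]

/-- Row `g` plus row `c * g` of the table is the all-ones row (Deligne Ex. 3.7 (d)). -/
theorem typeMatrix_add_conj_row {c : G} {Φ : Finset G} (hc : IsComplexConj c) (hΦ : IsCMType c Φ)
    (g s : G) : typeMatrix Φ g s + typeMatrix Φ (c * g) s = 1 := by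
  have h := ind_smul_add_ind_conj_smul hc hΦ g s
  rw [smul_smul] at h
  simpa [typeMatrix] using h

/-- Row `c * g` of the table is `1 − row g`. -/
theorem typeMatrix_row_conj {c : G} {Φ : Finset G} (hc : IsComplexConj c) (hΦ : IsCMType c Φ)
    (g : G) : typeMatrix Φ (c * g) = 1 - typeMatrix Φ g := by
  ext s
  have h := typeMatrix_add_conj_row hc hΦ g s
  simp only [Pi.sub_apply, Pi.one_apply]
  linarith

/-- The *weight* of the character `x_s` (`s ∈ G`) on the Mumford–Tate torus, in the coordinates
`⟨gμ, ·⟩`, `g ∈ G`: column `s` of the μ-table, `g ↦ [s ∈ gΦ]`. -/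
def weight (Φ : Finset G) (s : G) : G → ℚ := fun g => typeMatrix Φ g s

omit [Fintype G] in
/-- `weight Φ s g` unfolds to the indicator of `s ∈ gΦ`. -/
theorem weight_apply (Φ : Finset G) (s g : G) : weight Φ s g = if s ∈ g • Φ then 1 else 0 := rfl

omit [Fintype G] in
/-- Column `s` of the μ-table is the weight of `x_s`. -/
theorem weight_eq_col (Φ : Finset G) (s : G) : weight Φ s = fun g => (typeMatrix Φ).transpose s g := rfl

/-- The weight of the conjugate character `x_{cs}` is `1 − weight x_s` (Deligne Ex. 3.7 (d)). -/
theorem weight_conj {c : G} {Φ : Finset G} (hc : IsComplexConj c) (hΦ : IsCMType c Φ) (s : G) :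
    weight Φ (c * s) = 1 - weight Φ s := by
  ext g
  have h1 : c * s ∈ g • Φ ↔ s ∈ (c * g) • Φ := by rw [← smul_smul, hc.mem_smul_iff]
  have h2 := congrFun (typeMatrix_row_conj hc hΦ g) s
  simp only [Pi.sub_apply, Pi.one_apply] at h2
  simp only [weight, Pi.sub_apply, Pi.one_apply]
  rw [← h2]
  simp only [typeMatrix, ind, h1]

omit [Fintype G] in
/-- Galois action on weights: `weight x_{hs}(g) = weight x_s(h⁻¹ g)`. -/
theorem weight_smul (Φ : Finset G) (h s g : G) : weight Φ (h * s) g = weight Φ s (h⁻¹ * g) := by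
  have : h * s ∈ g • Φ ↔ s ∈ (h⁻¹ * g) • Φ := by
    rw [← smul_smul, ← inv_smul_mem_iff (a := h⁻¹), inv_inv, smul_eq_mul]
  simp only [weight, typeMatrix, ind, this]

omit [Fintype G] in
/-- The μ-value of `S` is the sum of the weights of the characters in `S`: `⟨gμ, x_S⟩ = Σ_{s∈S} w_s(g)`. -/
theorem sum_weight (Φ S : Finset G) (g : G) : ∑ s ∈ S, weight Φ s g = (muVal Φ S g : ℚ) := by
  simp only [weight, typeMatrix, ind, muVal]
  rw [Finset.sum_ite_mem, Finset.sum_const, nsmul_eq_mul, mul_one]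

/-- Weight form of Pohlmann's criterion: `Δ` (of size `2p`) is a Hodge set iff the sum of the weights
of its characters is the constant vector `p` (i.e. the character `x_Δ` restricted to the Mumford–Tate
torus is `p` times the weight of the central character). -/
theorem isHodgeSet_iff_sum_weight {c : G} {Φ : Finset G} (hc : IsComplexConj c) (hΦ : IsCMType c Φ)
    (Δ : Finset G) (p : ℕ) (hΔ : Δ.card = 2 * p) :
    IsHodgeSet c Φ Δ ↔ ∑ s ∈ Δ, weight Φ s = fun _ => (p : ℚ) := by
  rw [isHodgeSet_iff_muVal_eq hc hΦ Δ p hΔ]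
  constructor
  · intro h
    ext g
    rw [Finset.sum_apply, sum_weight, h g]
  · intro h g
    have := congrFun h g
    rw [Finset.sum_apply, sum_weight] at this
    exact_mod_cast this

end Table

end HodgeRepro
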